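import Summits.QuantumFields.BalabanUV.Beta.WardLocusStencils
import Summits.QuantumFields.BalabanUV.Beta.SpineRootedS0N

/-!
# `BalabanUV.Beta.WardLocusS0N` — binder row D1, the WARD binder hW, (W-LS0-lock): the block stencil Ward socket `hSd` at `j = 0` for
# the rooted native spine `S0NAt`, REDUCED TO THE WILSON SECTOR, and the scalar lock `cE' = 1/2` at the hR units fold

HONEST FRAMING (cell charter, verbatim): «discharging `BetaPertH` makes Bałaban's UV stability UNCONDITIONAL — a real constructive-QFT
result; it is NOT the continuum limit and NOT the Clay problem.»  DERIVED cell leaf (pub-balaban β sub-cell, D1 formalisation swarm seat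
`b2b-balaban-beta-d1-formalise-leaf-10`, on an1-g25's hW skeleton `HOME/b2b-balaban-beta-an1-g25/SKELETON-D1-hW.v1.md` §2 (W-LS)_0); every
declaration is [folklore] finite kernel algebra over objects ALREADY in the tree, cited BY NAME; no statement of Bałaban's papers is typed,
no `[cite:]` tag, no `def … : Prop`; it instantiates NO binder of the β-function wall.  NOT `BetaPertH`, NOT continuum, NOT Clay.
HONEST DEPENDENCY (cell records, verbatim): «continuum YM on T⁴ ⇐ BetaPertH ∧ nine spine estimates (0/9 proved); BetaPertH ⇐ (D1) ∧ (D4) ∧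
CAP+tail; G-an2-4 gates asym, D1 and NE2/3/4.»
ABSOLUTE RULE (cell charter, verbatim): «No internally-minted statement may enter as a cited fact. Every hypothesis is either kernel-proved in
this package or a verbatim quotation of a PUBLISHED theorem with page reference. The manuscript(s) under audit are NOT citable for their own
disputed steps — they are the thing under adjudication; programme-internal (2001/route/tribunal) claims are never citable.»

WHAT IS HERE (sequel of `WardLocusStencils`: the border dictionary (W-LS0-dict) and Λ-null (W-LS0-Λ) are there).  The hW root
`KernelWardRelative.wardTransversal_flipK_hessKer_conj_rel` / `SpineRooted.wardTransversal_flipK_TbalOf_JsBalBmNAtOf_ctrC_kernel` (p208276) carries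
  `hSd : ∀ y, cH • Σ_{v ∈ box} divV J.S (N•y + v) = conjV 𝕄 (X y)`.
At `j = 0`, `J.S = S0NAt ρ cE cVH cΛ` (an2, native placement), `𝕄₀ = bhKAt d ρ Lc` (p204639), `X y = diagK (ξ • Σ_v legInd ρ (Lc•y + v))`:
* `divV_S0NAt` — the divergence of the spine has NO Λ-part: `divV S0NAt u = cE • divV wilsonA u + cVH • divV (vhSAt ρ) u`;
* `hSd_defect_S0NAt` — `cH • Σ_v divV S0NAt − conjV 𝕄₀ (X y) = [cH·cE • Σ_v divV wilsonA − ξ • Σ_v conjV (ffK 𝕄₀) (diagK (legInd ρ ·))]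
  + (cH·cVH + ξ·Lc^{d+1}) • Σ_v divV (vhSAt ρ)`: a WILSON-SECTOR defect plus a pure vh term whose coefficient is the SCALAR LOCK;
* `hSd_S0NAt_of_wilsonWard` — if the Wilson cubic stencil obeys the (W-LS0-E) law pointwise with a constant `cE'`,
  `divV wilsonA u = cE' • conjV (ffK 𝕄₀) (diagK (legInd ρ u))` (a SOCKET, statement-level, NOT proved here; its right side is the `d*d`-window
  contact `bhK·([z = u] − [x = u])` on the field–field block, `WardLocusStencils.conjV_ffK_bhKAt_diagK_legInd_inl_inl`), then `hSd` holds for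
  every `(cH, ξ)` with `cH·cE·cE' = ξ` and `cH·cVH = −ξ·Lc^{d+1}`;
* `lock_solvable_iff`, `lock_at_units_fold` — both scalar conditions are solvable with `cH ≠ 0` iff `cE·cE'·Lc^{d+1} = −cVH`; at the hR units
  fold `(cE, cVH) = (2, −Lc^{d+1})` (R45 / an2 l.4657 / an1-g24 AUDIT l.4697) this reads **`cE' = 1/2`** — the number the Wilson Ward law
  (W-LS0-E) must produce for the wall literal to pass the hW socket at `j = 0` (cf. the hR twin `S0NAtReflection.S0NAt_bref_iff`:
  reflection law ⇔ `2·cVH = −cE·Lc^{d+1}`).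
Nothing here asserts the Wilson Ward law; nothing printed is a hypothesis.
-/

noncomputable section

open Finset
open scoped BigOperators
open Literature.MathematicalPhysics.QuantumFieldTheory
open Literature.MathematicalPhysics.QuantumFieldTheory.Balaban1983to89
open Literature.MathematicalPhysics.QuantumFieldTheory.Balaban1983to89.Beta
open ExpKernelCalculus (MKer Decays VertexFamily)
open OneStepResolventKernel (Fib)
open KernelWard (divV)
open StepJetData (wilsonA)
open AffineAveraging (box toSite)
open AveragingHessianKernelsRooted (vhSAt hessFFAt)
open InterLevelTransport (SLam)
open BalabanStepJets (lamCoeffOf)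
open Summit.QuantumFields.BalabanUV.Beta.ChartConjugation (conjV)
open Summit.QuantumFields.BalabanUV.Beta.BorderedHessian (bhKAt diagK diagK_apply conjV_diagK_apply)
open Summit.QuantumFields.BalabanUV.Beta.AveragingWardRootedStencils (legInd)
open Summit.QuantumFields.BalabanUV.Beta.SpineRooted (S0NAt)
open Summit.QuantumFields.BalabanUV.Beta.WardLocusStencils

namespace Summit.QuantumFields.BalabanUV.Beta.WardLocusS0N

variable {d : ℕ}

/-! ## §0 The diagonal contact is linear in its symbol -/

/-- [folklore] The diagonal contact is additive in the symbol: `conjV M (diagK (g₁ + g₂)) = conjV M (diagK g₁) + conjV M (diagK g₂)`. -/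
theorem conjV_diagK_add (M : MKer (d + 1) (Fib d)) (g₁ g₂ : (Fin (d + 1) → ℤ) → Fib d → ℝ) :
    conjV M (diagK (g₁ + g₂)) = conjV M (diagK g₁) + conjV M (diagK g₂) := by
  funext x z a b
  simp only [Pi.add_apply, conjV_diagK_apply]
  ring

/-- [folklore] … homogeneous in the symbol. -/
theorem conjV_diagK_smul (M : MKer (d + 1) (Fib d)) (c : ℝ) (g : (Fin (d + 1) → ℤ) → Fib d → ℝ) :
    conjV M (diagK (c • g)) = c • conjV M (diagK g) := by
  funext x z a b
  simp only [Pi.smul_apply, smul_eq_mul, conjV_diagK_apply]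
  ring

/-- [folklore] … and additive over finite families of symbols. -/
theorem conjV_diagK_sum {ι : Type*} (s : Finset ι) (M : MKer (d + 1) (Fib d)) (g : ι → (Fin (d + 1) → ℤ) → Fib d → ℝ) :
    conjV M (diagK (∑ i ∈ s, g i)) = ∑ i ∈ s, conjV M (diagK (g i)) := by
  classical
  induction s using Finset.induction_on with
  | empty =>
    funext x z a b
    simp only [Finset.sum_empty, conjV_diagK_apply, Pi.zero_apply, sub_self, mul_zero]
  | insert i s hi ih => rw [Finset.sum_insert hi, Finset.sum_insert hi, conjV_diagK_add, ih]

/-! ## (W-LS0-lock) The socket `hSd` for the rooted native spine `S0NAt` REDUCED TO THE WILSON SECTOR -/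

section Spine

variable {Lc : ℕ} [NeZero Lc]

/-- [folklore] **THE DIVERGENCE OF THE `j = 0` NATIVE SPINE HAS NO Λ-PART**: for an in-block root,
`divV (S0NAt ρ cE cVH cΛ) u = cE • divV wilsonA u + cVH • divV (vhSAt ρ) u` (Λ-null for `A := KInv Lc`, `Q2 := hessFFAt ρ Lc`:
`decays_KInv`, `biLoc_hessFFAt`). -/
theorem divV_S0NAt (hLc : 1 ≤ Lc) {r : Fin (d + 1) → ℕ} (hr : r ∈ box (d + 1) Lc) (cE cVH cΛ : ℝ) (u : Fin (d + 1) → ℤ) :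
    divV (S0NAt d Lc (toSite r) cE cVH cΛ) u = cE • divV (wilsonA d) u + cVH • divV (vhSAt (toSite r) d Lc) u := by
  obtain ⟨δ₀, C, hδ₀, hC, hdec⟩ := OneStepResolventKernel.decays_KInv (N := Lc) (d := d)
  have hQ : VertexFamily (fun μ y => hessFFAt (toSite r) Lc μ y) Lc
      (2 * (AveragingHessianKernels.ell (d + 1) Lc : ℝ) ^ 2 * Real.exp (4 * ((d : ℝ) + 1) * Lc * δ₀)) δ₀ :=
    fun μ y => AveragingHessianKernelsRooted.biLoc_hessFFAt hLc μ y hr hδ₀.le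
  have hΛ := divV_SLam_lamCoeffOf_eq_zero (N := Lc) hdec hC hδ₀ hQ u
  funext x z a b
  have hΛ' := congr_fun (congr_fun (congr_fun (congr_fun hΛ x) z) a) b
  simp only [divV_apply, Pi.zero_apply, Finset.sum_sub_distrib] at hΛ'
  simp only [divV_apply, Pi.add_apply, Pi.smul_apply, smul_eq_mul, S0NAt, Finset.sum_add_distrib, Finset.sum_sub_distrib,
    ← Finset.mul_sum]
  linear_combination cΛ * hΛ'

/-- [folklore] **THE SOCKET `hSd` SPLIT INTO ITS SECTORS.**  For the native spine `S0NAt ρ cE cVH cΛ`, the rooted bordered Hessian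
`bhKAt d ρ Lc` and the diagonal block-rotation generator with symbol `ξ • Σ_{v ∈ box} legInd ρ (Lc•y + v)`:
`cH • Σ_v divV S0NAt (Lc•y+v) − conjV (bhKAt) (diagK (ξ • Σ_v legInd ρ (Lc•y+v)))`
`= [cH·cE • Σ_v divV wilsonA − ξ • Σ_v conjV (ffK bhKAt) (diagK (legInd ρ ·))] + (cH·cVH + ξ·Lc^{d+1}) • Σ_v divV (vhSAt ρ)` —
the WILSON-SECTOR defect plus a pure vh term whose coefficient is the SCALAR LOCK. -/
theorem hSd_defect_S0NAt (hLc : 1 ≤ Lc) {r : Fin (d + 1) → ℕ} (hr : r ∈ box (d + 1) Lc) (cE cVH cΛ cH ξ : ℝ)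
    (y : Fin (d + 1) → ℤ) :
    cH • ∑ v ∈ box (d + 1) Lc, divV (S0NAt d Lc (toSite r) cE cVH cΛ) ((Lc : ℤ) • y + toSite v) -
        conjV (bhKAt d (toSite r) Lc) (diagK (ξ • ∑ v ∈ box (d + 1) Lc, legInd (toSite r) ((Lc : ℤ) • y + toSite v))) =
      ((cH * cE) • ∑ v ∈ box (d + 1) Lc, divV (wilsonA d) ((Lc : ℤ) • y + toSite v) -
          ξ • ∑ v ∈ box (d + 1) Lc, conjV (ffK (bhKAt d (toSite r) Lc)) (diagK (legInd (toSite r) ((Lc : ℤ) • y + toSite v)))) +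
        (cH * cVH + ξ * (Lc : ℝ) ^ (d + 1)) • ∑ v ∈ box (d + 1) Lc, divV (vhSAt (toSite r) d Lc) ((Lc : ℤ) • y + toSite v) := by
  rw [conjV_diagK_smul, conjV_diagK_sum]
  simp only [divV_S0NAt hLc hr, conjV_bhKAt_diagK_legInd (toSite r) Lc hLc, Finset.sum_add_distrib, Finset.sum_sub_distrib,
    Finset.smul_sum, smul_add, smul_sub, smul_smul, add_smul]
  funext x z a b
  simp only [Pi.add_apply, Pi.sub_apply, Pi.smul_apply, Finset.sum_apply, smul_eq_mul]
  ring

/-- [folklore] **`hSd` AT `j = 0` FROM A WILSON WARD LAW AND THE SCALAR LOCK.**  If the Wilson cubic stencil obeys the (W-LS0-E) law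
POINTWISE with some constant `cE'` — `divV wilsonA u = cE' • conjV (ffK (bhKAt d ρ Lc)) (diagK (legInd ρ u))` (a SOCKET: statement-level,
NOT proved in this file; its right side is the `d*d`-window contact `bhK·([z = u] − [x = u])` on the field–field block,
`conjV_ffK_bhKAt_diagK_legInd_inl_inl`) — then for every `(cH, ξ)` with `cH·cE·cE' = ξ` and `cH·cVH = −ξ·Lc^{d+1}` the socket `hSd` of
`KernelWardRelative.wardTransversal_flipK_hessKer_conj_rel` holds for `S0NAt ρ cE cVH cΛ`, `𝕄₀ = bhKAt d ρ Lc`,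
`X y = diagK (ξ • Σ_v legInd ρ (Lc•y + v))`. -/
theorem hSd_S0NAt_of_wilsonWard (hLc : 1 ≤ Lc) {r : Fin (d + 1) → ℕ} (hr : r ∈ box (d + 1) Lc) {cE cVH cΛ cH ξ cE' : ℝ}
    (hW : ∀ u : Fin (d + 1) → ℤ,
      divV (wilsonA d) u = cE' • conjV (ffK (bhKAt d (toSite r) Lc)) (diagK (legInd (toSite r) u)))
    (h₁ : cH * cE * cE' = ξ) (h₂ : cH * cVH = -(ξ * (Lc : ℝ) ^ (d + 1))) (y : Fin (d + 1) → ℤ) :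
    cH • ∑ v ∈ box (d + 1) Lc, divV (S0NAt d Lc (toSite r) cE cVH cΛ) ((Lc : ℤ) • y + toSite v) =
      conjV (bhKAt d (toSite r) Lc) (diagK (ξ • ∑ v ∈ box (d + 1) Lc, legInd (toSite r) ((Lc : ℤ) • y + toSite v))) := by
  rw [← sub_eq_zero, hSd_defect_S0NAt hLc hr]
  have hv : cH * cVH + ξ * (Lc : ℝ) ^ (d + 1) = 0 := by rw [h₂]; ring
  rw [hv, zero_smul, add_zero, sub_eq_zero]
  simp only [hW, Finset.smul_sum, smul_smul, h₁.symm]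

/-- [folklore] The same with an1's spelling of the generator, `X y = ξ • Σ_v diagK (legInd ρ (Lc•y + v))` (`diagK` is additive and homogeneous in
its symbol). -/
theorem diagK_smul_sum {ι : Type*} (s : Finset ι) (ξ : ℝ) (g : ι → (Fin (d + 1) → ℤ) → Fib d → ℝ) :
    diagK (ξ • ∑ i ∈ s, g i) = ξ • ∑ i ∈ s, diagK (g i) := by
  classical
  funext x z a b
  simp only [diagK_apply, Pi.smul_apply, Finset.sum_apply, smul_eq_mul]
  split_ifs with h
  · rfl
  · simp

/-- [folklore] **THE LOCK.**  The two scalar conditions admit a solution with `cH ≠ 0` iff `cE·cE'·P = −cVH` (`P = Lc^{d+1}`):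
the Ward locus fixes the RATIO `cE : cVH` once the Wilson constant `cE'` is known. -/
theorem lock_solvable_iff (cE cVH cE' P : ℝ) :
    (∃ cH ξ : ℝ, cH ≠ 0 ∧ cH * cE * cE' = ξ ∧ cH * cVH = -(ξ * P)) ↔ cE * cE' * P = -cVH := by
  constructor
  · rintro ⟨cH, ξ, hcH, h₁, h₂⟩
    rw [← h₁] at h₂
    have : cH * (cE * cE' * P + cVH) = 0 := by linear_combination h₂
    rcases mul_eq_zero.mp this with h | h
    · exact absurd h hcH
    · linarith
  · intro h
    refine ⟨1, cE * cE', one_ne_zero, by ring, ?_⟩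
    linear_combination h

/-- [folklore] **THE LOCK AT THE hR UNITS FOLD** `(cE, cVH) = (2, −Lc^{d+1})` (R45 / an2 l.4657 / an1-g24 AUDIT l.4697): the Wilson Ward law
must come with **`cE' = 1/2`** — the number (W-LS0-E) has to produce for the wall literal to pass the hW socket at `j = 0`. -/
theorem lock_at_units_fold {P cE' : ℝ} (hP : P ≠ 0) : (2 * cE' * P = -(-P)) ↔ cE' = 1 / 2 := by
  constructor
  · intro h
    have : (2 * cE' - 1) * P = 0 := by linear_combination h
    rcases mul_eq_zero.mp this with h' | h'
    · linarith
    · exact absurd h' hP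
  · intro h; rw [h]; ring

end Spine

end Summit.QuantumFields.BalabanUV.Beta.WardLocusS0N

end
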